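import Literature.MathematicalPhysics.QuantumFieldTheory.Balaban1983to89.B6Prop26Census2139KLevelV1
import Literature.MathematicalPhysics.QuantumFieldTheory.Balaban1983to89.B6Prop26HolderGrad2KLevelV1
import Literature.MathematicalPhysics.QuantumFieldTheory.Balaban1983to89.B6HolderGrad2NormSuppLegKLevelV1
import Literature.MathematicalPhysics.QuantumFieldTheory.Balaban1983to89.B6Ineq2134DivNormSuppKLevelV1
import Literature.MathematicalPhysics.QuantumFieldTheory.Balaban1983to89.B6LastLegsDivNormSuppKLevelV1
import HarnessLib

/-!
# `Balaban1983to89.B6Prop26Census2139OfLastLegsV1` — T. Bałaban, *Propagators and renormalization transformations for lattice gauge theories. II*,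
Comm. Math. Phys. **96** (1984) 223–250 [Balaban1984PropagatorsII], Prop. 2.6 (2.139) p. 247: **THE CENSUS SLOT c4 = (2.139) AT k LEVELS FROM THE
(2.138)-SHAPE INPUT (he4 = slot c3) AND THE LAST LEGS `R·∇*_μ` ON THE HÖLDER CLASS (hlast) — THE n = 0 LEGS NOW DISCHARGED.**

HONEST FRAMING (programme rule): statement-level skeleton of published theorems with citation tags; proofs where landed; nothing here
is a claim about the Yang–Mills mass gap.

The composition of this seat's three theorems: `…B6Prop26Census2139KLevelV1.prop26_census2139_kLevel_of_pair` (c4 ⇐ he4 ∧ hp4),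
`…B6Prop26HolderGrad2KLevelV1.holderGrad2_pair_kLevel_census` (hp4 ⇐ hlegs0 ∧ hlast) and `…B6HolderGrad2NormSuppLegKLevelV1.holderGrad2Leg0_pair_cube`
(hlegs0, a theorem) — so that the verbatim census slot c4 of `…B6Prop26PrintedStage2KLevelV1.prop26Printed_kLevel_of_slots5` now follows from the
slot-c3-shaped input (he4) and the single displayed input (hlast) = the last legs `R·∇*_μ` of the walk (2.141) on the class `‖·‖_{ε′} + |·|` (the
(2.134)-family bound on the Hölder class, the c3 lane's deliverable).

Then **`prop26_census2139_kLevel`**: the slot c4 HYPOTHESIS-FREE (only `hb₀ : 0 < b₀`, `hb₁ : b₀ ≤ b₁`), by plugging n03-b's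
`…B6Ineq2134DivNormSuppKLevelV1.ineq2138_kLevel_census` (slot c3, hypothesis-free) and `divLegs_kLevel` (the per-pair legs family on the Hölder class)
through dag-p1's glue `…B6LastLegsDivNormSuppKLevelV1.lastLegs_kLevel_of_divLegs` (hlast ⇐ divLegs).

HONEST SCOPE: bookkeeping only (two `exact`s); census sub-case `supp J ⊂ Δ(y′)` (GAPS G-B6-2138-SUPP); V1 tori; constants `C_{αε} → ∞` as `ε → 0`
as printed.  NOT summit progress.  Unit `pub-ymgap-dag-n02-b` (Track-A seat, D-0062; slot c4 of node N03), 2026-08-26.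
-/

noncomputable section

open scoped BigOperators
open Finset

namespace Literature.MathematicalPhysics.QuantumFieldTheory.Balaban1983to89.B6Prop26Census2139OfLastLegsV1

open scoped BigOperators
open Finset
open LatticeFieldCalculus
open B6MultiLevelBoxOperator (N0)
open B6MultiLevelTorusOperator (TDomains)
open B6Cover236MultiLevelBlocks (cubes)
open B6Geom246MultiLevelBox (bset)
open B6Geom246MultiLevelTorus (geomT lemma21_torus triangle_refl_nonneg_T)
open B8Ineq192MultiLevelTorus (geomTB geomTB_len geomT_len lenT_pos symmT)
open B6RandomWalk (HasMajorant hasMajorant_mono delta3 delta3_pos BlockSupp)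
open B6RandomWalkInputNorm (HasMajorantA NormSupp hasMajorantA_mono hasMajorantA_finsetSum normSupp_nonneg)
open B6RandomWalkInputNormChain (conj_fixedPoint hasMajorantA_affine conv_two_le_of_ineq263With)
open B6Prop26Gluing (mulOp ind ind_nonneg ind_of_mem ind_of_not_mem sum_ind_eq_card)
open B6Prop26 (fixedPoint_of_291)
open B6Lemma21Repaired (Ineq263With)
open B6Ineq261LevelGap (K261 K261_nonneg)
open B6Eq291Generator (kFam gZero rOp eq291)
open B6Ineq2133TwoScaleV1 (onFun)
open B6GlobalChartV1 (PV domT blkV1)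
open B6AgreeLapV1Chart (deltaAE_split)
open B6SectAOperatorsV1 (dE dsE dcE dcsE QE aE QsE RE BondIdx)
open B6SectAVectorModelV1 (deltaAE GE)
open B6Partition118KLevelTorusCentral (one_le_of_four_le)
open B6Prop26KLevelSkeletonV1 (hB zB ST sum_mulOp_hB_sq mulOp_zB_mul_hB mulOp_hB_mul_zB onFun_GE_mul_deltaAE)
open B6Prop26KLevelSkeletonV2 (SbigT ST_subset_SbigT hNov_SbigT_of_QbigT card_filter_mono)
open B6Prop26KLevelAssemblyV1 (distT_nonneg)
open B6Cover236QbigOverlapV1 (card_filter_mem_QbigT_le)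
open B6CubeWindowV1 (Placed Gl Ml Pl GlobalBand hagree_cube hinvl_cube band_of_global band_le one_le_of_eight_le four_le_of_five_le)
open B6Prop26DivLegKLevelV1 (len_le_of_levelGap)
open B6GradLegKLevelV1 (DV)
open B6LapLegKLevelV1 (DVa)
open B6HolderPairMemberV1 (pairOp)
open B6HolderNormV1 (holderV1 supNormV1)
open B6Cor28HolderUnifKLevelV1 (ineq2137_grad_kLevel_unif)
open Classical in
open Classical in
open Classical in
open Classical in
open B6SectAOperatorsV1 (BondIdx)
open B6SectAVectorModelV1 (GE)
open B6RandomWalk (HasMajorant BlockSupp)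
open B6RandomWalkInputNorm (HasMajorantA NormSupp)
open B6Geom246MultiLevelTorus (geomT)
open B8Ineq192MultiLevelTorus (lenT_eq lenT_pos symmT)
open B6CubeWindowV1 (Placed GlobalBand)
open B6HolderPairMemberV1 (pairOp pairOp_mul_apply abs_cutoff_pair_le)
open B6KLevelCensusIndexV1 (KIdx Adm tpar kGeoG lenG_eq_geomT adm_symm tpar_nonneg tpar_le_one)
open B6KLevelCensusBookkeepingV1 (quot_cancel adjLen_le_L exp_adj_le eq_of_supDist_eq_zero)
open B6Prop26Census2136KLevelV1 (Gop supIn holderQ kG)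
open B6HolderNormV1 (holderV1 supNormV1 abs_apply_le_of_suppIn kGeoG_holder_eq kGeoG_supNorm_eq holderV1_nonneg supNormV1_nonneg)
open B3TorusRadialSums (supDist_comm)
open B6Prop26Census2139KLevelV1 (prop26_census2139_kLevel_of_pair)
open B6Prop26HolderGrad2KLevelV1 (holderGrad2_pair_kLevel_census)
open B6HolderGrad2NormSuppLegKLevelV1 (holderGrad2Leg0_pair_cube)
open B6Ineq2134DivNormSuppKLevelV1 (divLegs_kLevel ineq2138_kLevel_census)
open B6LastLegsDivNormSuppKLevelV1 (lastLegs_kLevel_of_divLegs)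

variable {d ℓ : ℕ} {hd : 1 ≤ d + 1} {hL : Odd (ℓ + 1) ∧ 1 < ℓ + 1} {b₀ b₁ : ℝ}

open Classical in
/-- **THE CENSUS SLOT c4 = [B6] (2.139) AT k LEVELS FROM (he4) AND THE LAST LEGS (hlast)**: the verbatim slot
`∃ M₁ δ₃ Cαε, … (kG i).h2 J α ζ ≤ Cαε α ε·(len y)^{−α}·cutH α ζ·e^{−δ₃d(y,y′)}·(‖J‖_{α+ε} + |J|)` of the printed k-level Prop. 2.6 follows from the
(2.138)-shaped entry bound (he4) and the last legs `R·∇*_μ` on the Hölder class (hlast) — the n = 0 legs of the two-difference walk being this seat's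
theorem `holderGrad2Leg0_pair_cube` (band `a₀ = b₀/L ≤ a₁ = b₁L^d`, `band_le`).
[cite: Balaban1984PropagatorsII, Prop. 2.6 (2.139) p.247, (2.141) p.247, (2.136)–(2.138) p.247; Balaban1984PropagatorsI, (1.109) p.35, (1.113) p.36] -/
theorem prop26_census2139_kLevel_of_lastLegs (hb₀ : 0 < b₀) (hb₁ : b₀ ≤ b₁)
    (he4 : ∃ M₁ δ₃ : ℝ, ∃ Cε : ℝ → ℝ, 0 < M₁ ∧ 0 < δ₃ ∧ ∀ i : KIdx d ℓ hd hL b₀ b₁, M₁ ≤ (kGeoG i).M →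
      ∀ (ε : ℝ) (J : (kGeoG i).Loc) (y y' : (kGeoG i).Site), 0 < ε → ε < 1 → (kGeoG i).suppIn J y' →
        (kG i).e4 J y ≤ Cε ε * Real.exp (-(δ₃ * (kGeoG i).dist y y')) * ((kGeoG i).holder ε J + (kGeoG i).supNorm J))
    (hlast : ∃ (σ₀ M₀ : ℝ) (N' : ℕ), 0 < σ₀ ∧ 0 < M₀ ∧ ∀ (ε' : ℝ), 0 < ε' → ε' < 1 → ∃ θ : ℝ, 0 ≤ θ ∧
      ∀ (m K : ℕ) {Mh k R : ℕ} {P' : Fin (d + 1) → ℕ}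
        (hN : ∀ μ, N0 ℓ Mh k P' μ = (PV d ℓ m K hd hL).sitesPerDir 0) (D : TDomains d ℓ Mh k P' R) (hk : k ≤ m + K) (_ : 2 ≤ k)
        {a : ℕ} (hMha : Mh = (ℓ + 1) ^ a) (hM8 : 8 ≤ Mh) (_ : 2 * (ℓ + 1) ^ 2 ≤ R) (hP5 : ∀ μ, 5 ≤ P' μ) (_ : 4 ≤ ℓ)
        (hpl : ∀ c : ↥(cubes D.toDomains), Placed ℓ k P' c.1) (_ : M₀ ≤ ((ℓ : ℝ) + 1) * Mh) (_ : N' + 1 ≤ R * ((ℓ + 1) * Mh))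
        {cf : ℝ} (hcf : cf ≠ 0) {w : BondIdx (domT hN D hk) → ℝ} (hw : ∀ i, 0 < w i) (_ : GlobalBand b₀ b₁ cf w) (μ : Fin (d + 1)),
        HasMajorantA (g := geomT D) (blkV1 hN D)
          (NormSupp (g := geomT D) (blkV1 hN D) (fun y' => ({y'} : Set (geomT D).Site)) (fun _ J => holderV1 hN D ε' J + supNormV1 J))
          (rOp Finset.univ (onFun (dE (P := PV d ℓ m K hd hL) cf ∘ₗ (LinearMap.id - RE (domT hN D hk) cf) ∘ₗ dsE cf))
              (fun c => mulOp (hB hN D c)) (fun c => mulOp (zB hN D (one_le_of_eight_le hM8) (four_le_of_five_le hP5) c))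
              (fun c => Gl hN hk (one_le_of_eight_le hM8) (four_le_of_five_le hP5) hMha c (band_le (d := d) (ℓ := ℓ) hb₀ hb₁) (hpl c) w cf)
              (fun c => Ml hN hk (one_le_of_eight_le hM8) (four_le_of_five_le hP5) hMha c (band_le (d := d) (ℓ := ℓ) hb₀ hb₁) (hpl c) w cf)
              (fun c => Pl hN hk (one_le_of_eight_le hM8) (four_le_of_five_le hP5) hMha c (band_le (d := d) (ℓ := ℓ) hb₀ hb₁) (hpl c) w cf) *
            DVa (P := PV d ℓ m K hd hL) μ cf)
          (fun y y' => θ * ((geomT D).len y' * |cf|⁻¹)⁻¹ * Real.exp (-(σ₀ * (geomT D).dist y y')))) :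
    ∃ M₁ δ₃ : ℝ, ∃ Cαε : ℝ → ℝ → ℝ, 0 < M₁ ∧ 0 < δ₃ ∧ ∀ i : KIdx d ℓ hd hL b₀ b₁, M₁ ≤ (kGeoG i).M →
      ∀ (α ε : ℝ) (J : (kGeoG i).Loc) (ζ : (kGeoG i).Cut) (y y' : (kGeoG i).Site), 0 ≤ α → 0 < ε → α + ε < 1 →
        (kGeoG i).cutIn ζ y → (kGeoG i).suppIn J y' →
        (kG i).h2 J α ζ ≤ Cαε α ε * ((kGeoG i).len y) ^ (-α) * (kGeoG i).cutH α ζ * Real.exp (-(δ₃ * (kGeoG i).dist y y')) *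
          ((kGeoG i).holder (α + ε) J + (kGeoG i).supNorm J) :=
  prop26_census2139_kLevel_of_pair he4
    (holderGrad2_pair_kLevel_census hb₀ hb₁
      (holderGrad2Leg0_pair_cube d ℓ hd hL (a₀ := b₀ / ((ℓ + 1 : ℕ) : ℝ)) (by positivity) (band_le (d := d) (ℓ := ℓ) hb₀ hb₁)) hlast)

open Classical in
/-- **THE CENSUS SLOT c4 = [B6] PROP. 2.6 (2.139) AT k LEVELS, HYPOTHESIS-FREE** (beyond the weight band `0 < b₀ ≤ b₁` of the census index): the
verbatim slot c4 of `…B6Prop26PrintedStage2KLevelV1.prop26Printed_kLevel_of_slots5` — `‖ζ∇_νG∇_μ*J‖_α ≤ C_{αε}(L^{j}η)^{−α}(‖ζ‖_α + |ζ|)e^{−δ₃d(y,y′)}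
(‖J‖_{α+ε} + |J|)` in the census reading — from `prop26_census2139_kLevel_of_lastLegs` with (he4) := n03-b's `ineq2138_kLevel_census` (slot c3) and
(hlast) := dag-p1's `lastLegs_kLevel_of_divLegs` ∘ n03-b's `divLegs_kLevel`.
[cite: Balaban1984PropagatorsII, Prop. 2.6 (2.139) p.247, (2.138) p.247, (2.141) p.247, (2.134)–(2.135) p.247; Balaban1984PropagatorsI, (1.113) p.36] -/
theorem prop26_census2139_kLevel (hb₀ : 0 < b₀) (hb₁ : b₀ ≤ b₁) :
    ∃ M₁ δ₃ : ℝ, ∃ Cαε : ℝ → ℝ → ℝ, 0 < M₁ ∧ 0 < δ₃ ∧ ∀ i : KIdx d ℓ hd hL b₀ b₁, M₁ ≤ (kGeoG i).M →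
      ∀ (α ε : ℝ) (J : (kGeoG i).Loc) (ζ : (kGeoG i).Cut) (y y' : (kGeoG i).Site), 0 ≤ α → 0 < ε → α + ε < 1 →
        (kGeoG i).cutIn ζ y → (kGeoG i).suppIn J y' →
        (kG i).h2 J α ζ ≤ Cαε α ε * ((kGeoG i).len y) ^ (-α) * (kGeoG i).cutH α ζ * Real.exp (-(δ₃ * (kGeoG i).dist y y')) *
          ((kGeoG i).holder (α + ε) J + (kGeoG i).supNorm J) :=
  prop26_census2139_kLevel_of_lastLegs hb₀ hb₁ (ineq2138_kLevel_census d ℓ hd hL hb₀ hb₁)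
    (lastLegs_kLevel_of_divLegs hb₀ hb₁ (divLegs_kLevel d ℓ hd hL hb₀ hb₁))

end Literature.MathematicalPhysics.QuantumFieldTheory.Balaban1983to89.B6Prop26Census2139OfLastLegsV1

end
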